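import Summits.Ventures.CertifiedArithmetic.LowPrec.EnvelopesMixedE3M2

/-!
# Exhaustive envelopes of the MIXED FP6 pair `E3M2 ∘ E2M3` delivered in `E2M3` under RNE

HONEST FRAMING (venture CertifiedArithmetic / cell `pub-lowprec`): certified error envelopes and
provably optimal rounding/accumulation schemes for low-precision formats under stated cost models;
every table by two implementations; no hardware or vendor claims.

NEW WORK of the venture: heterogeneous operands (`a : E3M2`, `b : E2M3`, 64 × 64 ordered pairs),
exact product / sum rounded into `E2M3` by `roundNE` (RNE, saturating). Kernel-checked
(`decide +kernel`) envelopes by exponent code of the rounded result, sharp in-range relative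
constants, and exact / overflow counts; implementation A/B counterpart: enum canary pair
`ocp_e3m2__ocp_e2m3`. Destination `E2M3`: small sums are NOT exact (the `E3M2` operand has quantum `1/16 <` the `E2M3` quantum `1/8`), so the sum envelope is `1/16` already in codes 0 and 1.
-/

namespace Summit.Ventures.CertifiedArithmetic

open Literature.ComputerArithmetic.FloatingPoint
open Literature.ComputerArithmetic.FloatingPoint.MiniFloat
open Literature.ComputerArithmetic.FloatingPoint.Format

/-- `E3M2 · E2M3 → E2M3`, absolute envelope by result exponent code: `[1/16, 1/16, 1/8, 1/4]` (half the spacing of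
each binade of `E2M3`), for in-range products. -/
theorem E3M2_E2M3_mul_E2M3_abs_envelope (a : MiniFloat E3M2) (b : MiniFloat E2M3)
    (h : |a.toRat * b.toRat| ≤ E2M3.maxRat) :
    |(roundNE E2M3 (a.toRat * b.toRat)).toRat - a.toRat * b.toRat|
      ≤ ([1/16, 1/16, 1/8, 1/4] : List ℚ).getD (roundNE E2M3 (a.toRat * b.toRat)).expCode 0 := by
  have := forall₂_of_all_all (P := envTestH E2M3 (· * ·) [1/16, 1/16, 1/8, 1/4]) (by decide +kernel) a b
  exact of_decide_eq_true this h

/-- `E3M2 + E2M3 → E2M3`, absolute envelope by result exponent code: `[1/16, 1/16, 1/8, 1/4]`. -/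
theorem E3M2_E2M3_add_E2M3_abs_envelope (a : MiniFloat E3M2) (b : MiniFloat E2M3)
    (h : |a.toRat + b.toRat| ≤ E2M3.maxRat) :
    |(roundNE E2M3 (a.toRat + b.toRat)).toRat - (a.toRat + b.toRat)|
      ≤ ([1/16, 1/16, 1/8, 1/4] : List ℚ).getD (roundNE E2M3 (a.toRat + b.toRat)).expCode 0 := by
  have := forall₂_of_all_all (P := envTestH E2M3 (· + ·) [1/16, 1/16, 1/8, 1/4]) (by decide +kernel) a b
  exact of_decide_eq_true this h

/-- `E3M2 + E2M3 → E2M3`, relative envelope in range: `|err| ≤ 1 · |a+b|` (the constant is `1`: `E3M2` summands of size `1/16` are ties below the `E2M3` quantum `1/8` and round to `0`; on normal-range results the sharp constant is `1/17`). -/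
theorem E3M2_E2M3_add_E2M3_rel_envelope (a : MiniFloat E3M2) (b : MiniFloat E2M3)
    (h : |a.toRat + b.toRat| ≤ E2M3.maxRat) (h0 : a.toRat + b.toRat ≠ 0) :
    |(roundNE E2M3 (a.toRat + b.toRat)).toRat - (a.toRat + b.toRat)| ≤ 1 * |a.toRat + b.toRat| := by
  have := forall₂_of_all_all (P := relTestH E2M3 (· + ·) (1)) (by decide +kernel) a b
  exact of_decide_eq_true this h h0

/-- `E3M2 ∘ E2M3 → E2M3` COUNTS over the 4096 ordered pairs: exact products / sums and overflowing
(`|t| > maxRat E2M3`) products / sums = (1216, 1704, 1428, 1152). -/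
theorem E3M2_E2M3_E2M3_counts :
    countPairsH E3M2 E2M3 (fun a b => decide ((roundNE E2M3 (a.toRat * b.toRat)).toRat = a.toRat * b.toRat)) = 1216 ∧
    countPairsH E3M2 E2M3 (fun a b => decide ((roundNE E2M3 (a.toRat + b.toRat)).toRat = a.toRat + b.toRat)) = 1704 ∧
    countPairsH E3M2 E2M3 (fun a b => decide (E2M3.maxRat < |a.toRat * b.toRat|)) = 1428 ∧
    countPairsH E3M2 E2M3 (fun a b => decide (E2M3.maxRat < |a.toRat + b.toRat|)) = 1152 := by
  decide +kernel

end Summit.Ventures.CertifiedArithmetic
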